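import Literature.Analysis.Complex.Montel
import Mathlib.Analysis.Analytic.IsolatedZeros
import Mathlib.Analysis.Distribution.AEEqOfIntegralContDiff
import Mathlib.MeasureTheory.Integral.DominatedConvergence
import HarnessLib

/-!
# Vitali's convergence theorem for sequences of holomorphic functions

Analysis/Complex support file (everything proved; no definitions, no named facts). The classical
companion of Montel's theorem (`Literature/Analysis/Complex/Montel.lean`): a locally bounded
sequence of holomorphic functions on an open set `U ⊆ ℂ` **converges locally uniformly as soon as
its possible limits are unique** — every subsequence has a locally uniformly convergent
subsequence (Montel), and if all these limits coincide the whole sequence converges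
(`exists_tendstoLocallyUniformlyOn_of_unique_limits`, the subsequence principle). Two criteria
for the uniqueness of the limits on a connected `U` are supplied, each an instance of the identity
theorem:

* `eqOn_of_subseq_limits_of_frequently_tendsto` — the sequence converges pointwise on a set
  accumulating at a point of `U` (**Vitali's theorem**, G. Vitali 1903 / M. B. Porter 1904;
  Titchmarsh, *The Theory of Functions*, §5.21; Conway VII, Exercise 2.4), whence
  `exists_tendstoLocallyUniformlyOn_of_frequently_tendsto`;
* `eqOn_of_subseq_limits_of_integral_tendsto` — the pairings `∫ g(t) F_n(t) dt` against all smooth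
  `g` compactly supported in a real interval `(a, b) ⊆ U` converge (**distributional convergence
  on a real segment**), whence `exists_tendstoLocallyUniformlyOn_of_integral_tendsto`: this is the
  form in which analytic continuations of Schwinger functions regularised in a time variable are
  shown to converge when the regularisation is removed (Osterwalder–Schrader II, Comm. Math.
  Phys. 42 (1975), Ch. V).

Everything here is standard and tagged folklore.
-/

noncomputable section

open Filter Set Metric MeasureTheory Topology Complex
open scoped ContDiff

namespace Literature.Analysis.Complex

variable {U : Set ℂ}

/-! ### The subsequence principle -/

/-- Local boundedness passes to subsequences. [folklore] -/
theorem locallyBounded_comp {F : ℕ → ℂ → ℂ}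
    (hb : ∀ a ∈ U, ∃ M : ℝ, ∃ r > 0, ∀ n, ∀ z ∈ ball a r ∩ U, ‖F n z‖ ≤ M) (ψ : ℕ → ℕ) :
    ∀ a ∈ U, ∃ M : ℝ, ∃ r > 0, ∀ n, ∀ z ∈ ball a r ∩ U, ‖F (ψ n) z‖ ≤ M := fun a ha => by
  obtain ⟨M, r, hr, hM⟩ := hb a ha
  exact ⟨M, r, hr, fun n z hz => hM (ψ n) z hz⟩

/-- **Locally uniform convergence from the uniqueness of subsequential limits.** Let
`F : ℕ → ℂ → ℂ` be holomorphic and locally bounded on an open `U`. If any two locally uniform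
limits of subsequences of `F` agree on `U`, then `F` converges locally uniformly on `U` to a
holomorphic function (Montel's theorem and the subsequence principle). [folklore] -/
theorem exists_tendstoLocallyUniformlyOn_of_unique_limits (hU : IsOpen U) {F : ℕ → ℂ → ℂ}
    (hF : ∀ n, DifferentiableOn ℂ (F n) U)
    (hb : ∀ a ∈ U, ∃ M : ℝ, ∃ r > 0, ∀ n, ∀ z ∈ ball a r ∩ U, ‖F n z‖ ≤ M)
    (huniq : ∀ (f f' : ℂ → ℂ) (ψ ψ' : ℕ → ℕ), StrictMono ψ → StrictMono ψ' →
      TendstoLocallyUniformlyOn (fun n => F (ψ n)) f atTop U →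
      TendstoLocallyUniformlyOn (fun n => F (ψ' n)) f' atTop U → EqOn f f' U) :
    ∃ f : ℂ → ℂ, DifferentiableOn ℂ f U ∧ TendstoLocallyUniformlyOn F f atTop U := by
  obtain ⟨f, φ, hφ, hlim⟩ := Complex.exists_strictMono_tendstoLocallyUniformlyOn hU hF hb
  refine ⟨f, hlim.differentiableOn (Eventually.of_forall fun n => hF _) hU, ?_⟩
  rw [tendstoLocallyUniformlyOn_iff_forall_isCompact hU]
  intro K hKU hK
  by_contra hnot
  rw [Metric.tendstoUniformlyOn_iff] at hnot
  push Not at hnot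
  obtain ⟨ε, hε, hfreq⟩ := hnot
  obtain ⟨ψ, hψ, hbad⟩ := extraction_of_frequently_atTop hfreq
  -- a convergent subsequence of the bad subsequence
  obtain ⟨f', χ, hχ, hlim'⟩ := Complex.exists_strictMono_tendstoLocallyUniformlyOn hU
    (fun n => hF (ψ n)) (locallyBounded_comp hb ψ)
  have heq : EqOn f f' U := huniq f f' φ (ψ ∘ χ) hφ (hψ.comp hχ) hlim hlim'
  have hK' := (tendstoLocallyUniformlyOn_iff_forall_isCompact hU).1 hlim' K hKU hK
  rw [Metric.tendstoUniformlyOn_iff] at hK'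
  obtain ⟨N, hN⟩ := eventually_atTop.1 (hK' ε hε)
  obtain ⟨x, hxK, hx⟩ := hbad (χ N)
  have h1 : dist (f' x) (F (ψ (χ N)) x) < ε := hN N le_rfl x hxK
  rw [← heq (hKU hxK)] at h1
  exact absurd h1 (not_lt.2 hx)

/-! ### Uniqueness of the limits from pointwise convergence on a set with an accumulation point -/

/-- Two subsequential locally uniform limits agree wherever the full sequence converges. [folklore] -/
theorem subseq_limits_eq_of_tendsto {F : ℕ → ℂ → ℂ} {f f' : ℂ → ℂ} {ψ ψ' : ℕ → ℕ}
    (hψ : StrictMono ψ) (hψ' : StrictMono ψ')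
    (hlim : TendstoLocallyUniformlyOn (fun n => F (ψ n)) f atTop U)
    (hlim' : TendstoLocallyUniformlyOn (fun n => F (ψ' n)) f' atTop U) {z : ℂ} (hz : z ∈ U)
    {c : ℂ} (hc : Tendsto (fun n => F n z) atTop (𝓝 c)) : f z = f' z := by
  have h1 : Tendsto (fun n => F (ψ n) z) atTop (𝓝 (f z)) := hlim.tendsto_at hz
  have h2 : Tendsto (fun n => F (ψ' n) z) atTop (𝓝 (f' z)) := hlim'.tendsto_at hz
  have h1' : Tendsto (fun n => F (ψ n) z) atTop (𝓝 c) := hc.comp hψ.tendsto_atTop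
  have h2' : Tendsto (fun n => F (ψ' n) z) atTop (𝓝 c) := hc.comp hψ'.tendsto_atTop
  rw [tendsto_nhds_unique h1 h1', tendsto_nhds_unique h2 h2']

/-- **Uniqueness of subsequential limits from pointwise convergence near a point** (the identity
theorem): on a connected open `U`, if the sequence converges pointwise frequently near `z₀ ∈ U`
(e.g. on a set accumulating at `z₀`), any two locally uniform limits of subsequences agree. [folklore] -/
theorem eqOn_of_subseq_limits_of_frequently_tendsto (hU : IsOpen U) (hUc : IsPreconnected U)
    {F : ℕ → ℂ → ℂ} (hF : ∀ n, DifferentiableOn ℂ (F n) U) {z₀ : ℂ} (hz₀ : z₀ ∈ U)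
    (hS : ∃ᶠ z in 𝓝[≠] z₀, ∃ c : ℂ, Tendsto (fun n => F n z) atTop (𝓝 c))
    {f f' : ℂ → ℂ} {ψ ψ' : ℕ → ℕ} (hψ : StrictMono ψ) (hψ' : StrictMono ψ')
    (hlim : TendstoLocallyUniformlyOn (fun n => F (ψ n)) f atTop U)
    (hlim' : TendstoLocallyUniformlyOn (fun n => F (ψ' n)) f' atTop U) : EqOn f f' U := by
  have hfa : AnalyticOnNhd ℂ f U :=
    (hlim.differentiableOn (Eventually.of_forall fun n => hF _) hU).analyticOnNhd hU
  have hfa' : AnalyticOnNhd ℂ f' U :=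
    (hlim'.differentiableOn (Eventually.of_forall fun n => hF _) hU).analyticOnNhd hU
  have hUn : U ∈ 𝓝 z₀ := hU.mem_nhds hz₀
  have hfreq : ∃ᶠ z in 𝓝[≠] z₀, f z = f' z := by
    have hev : ∀ᶠ z in 𝓝[≠] z₀, z ∈ U := mem_nhdsWithin_of_mem_nhds hUn
    refine (hS.and_eventually hev).mono fun z hz => ?_
    obtain ⟨⟨c, hc⟩, hzU⟩ := hz
    exact subseq_limits_eq_of_tendsto hψ hψ' hlim hlim' hzU hc
  exact hfa.eqOn_of_preconnected_of_frequently_eq hfa' hUc hz₀ hfreq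

/-- **Vitali's convergence theorem.** A locally bounded sequence of holomorphic functions on a
connected open set `U ⊆ ℂ` which converges pointwise frequently near a point of `U` (in
particular: on a subset of `U` with an accumulation point in `U`) converges locally uniformly on
`U` to a holomorphic function. [folklore] -/
theorem exists_tendstoLocallyUniformlyOn_of_frequently_tendsto (hU : IsOpen U)
    (hUc : IsPreconnected U) {F : ℕ → ℂ → ℂ} (hF : ∀ n, DifferentiableOn ℂ (F n) U)
    (hb : ∀ a ∈ U, ∃ M : ℝ, ∃ r > 0, ∀ n, ∀ z ∈ ball a r ∩ U, ‖F n z‖ ≤ M)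
    {z₀ : ℂ} (hz₀ : z₀ ∈ U)
    (hS : ∃ᶠ z in 𝓝[≠] z₀, ∃ c : ℂ, Tendsto (fun n => F n z) atTop (𝓝 c)) :
    ∃ f : ℂ → ℂ, DifferentiableOn ℂ f U ∧ TendstoLocallyUniformlyOn F f atTop U :=
  exists_tendstoLocallyUniformlyOn_of_unique_limits hU hF hb fun _ _ _ _ hψ hψ' hlim hlim' =>
    eqOn_of_subseq_limits_of_frequently_tendsto hU hUc hF hz₀ hS hψ hψ' hlim hlim'

/-! ### Uniqueness of the limits from distributional convergence on a real segment -/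

/-- A continuous function on an open real interval vanishing almost everywhere there vanishes
there. [folklore] -/
theorem eq_zero_of_ae_of_continuousOn {h : ℝ → ℂ} {a b : ℝ} (hc : ContinuousOn h (Ioo a b))
    (hae : ∀ᵐ t : ℝ, t ∈ Ioo a b → h t = 0) {t₀ : ℝ} (ht₀ : t₀ ∈ Ioo a b) : h t₀ = 0 := by
  by_contra hne
  have hpos : 0 < ‖h t₀‖ := norm_pos_iff.2 hne
  have hct : ContinuousAt h t₀ := hc.continuousAt (isOpen_Ioo.mem_nhds ht₀)
  have hev : ∀ᶠ t in 𝓝 t₀, ‖h t - h t₀‖ < ‖h t₀‖ := by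
    have h1 : Tendsto (fun t => ‖h t - h t₀‖) (𝓝 t₀) (𝓝 0) := by
      have h2 := (hct.sub_const (h t₀)).norm
      simpa using h2
    exact h1 (Iio_mem_nhds hpos)
  obtain ⟨δ, hδ, hball⟩ := Metric.eventually_nhds_iff.1 (hev.and (isOpen_Ioo.mem_nhds ht₀))
  -- the ball is a null set: contradiction with its positive measure
  have hnull : volume (ball t₀ δ) = 0 := by
    refine measure_mono_null (fun t ht => ?_) (ae_iff.1 hae)
    obtain ⟨h1, h2⟩ := hball ht
    simp only [mem_setOf_eq, Classical.not_imp]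
    refine ⟨h2, fun h0 => ?_⟩
    rw [h0, zero_sub, norm_neg] at h1
    exact lt_irrefl _ h1
  have hposm : 0 < volume (ball t₀ δ) := measure_ball_pos volume t₀ hδ
  rw [hnull] at hposm
  exact lt_irrefl _ hposm

/-- Uniform convergence on the support of a test function gives convergence of the pairings
`∫ g(t) F_n(t) dt → ∫ g(t) f(t) dt` (dominated convergence on the compact support). [folklore] -/
theorem tendsto_integral_smul_of_tendstoLocallyUniformlyOn (hU : IsOpen U) {F : ℕ → ℂ → ℂ}
    {f : ℂ → ℂ} (hF : ∀ n, DifferentiableOn ℂ (F n) U) (hlim : TendstoLocallyUniformlyOn F f atTop U)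
    {g : ℝ → ℝ} (hg : Continuous g) (hgs : HasCompactSupport g)
    (hgU : ∀ t ∈ tsupport g, (t : ℂ) ∈ U) :
    Tendsto (fun n => ∫ t : ℝ, g t • F n t) atTop (𝓝 (∫ t : ℝ, g t • f t)) := by
  have hfc : ContinuousOn f U :=
    hlim.continuousOn (Eventually.of_forall fun n => (hF n).continuousOn).frequently
  set S : Set ℝ := tsupport g with hS
  have hSc : IsCompact S := hgs
  -- all integrals live on `S`
  have hconv : ∀ φ : ℂ → ℂ, ∫ t : ℝ, g t • φ t = ∫ t in S, g t • φ t := fun φ =>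
    (setIntegral_eq_integral_of_forall_compl_eq_zero fun t ht => by
      rw [image_eq_zero_of_notMem_tsupport ht, zero_smul]).symm
  simp_rw [hconv]
  -- the compact set `K = S ⊆ ℝ ⊆ ℂ`
  set K : Set ℂ := ((↑) : ℝ → ℂ) '' S with hK
  have hKc : IsCompact K := hSc.image continuous_ofReal
  have hKU : K ⊆ U := by rintro _ ⟨t, ht, rfl⟩; exact hgU t ht
  have hmemK : ∀ t ∈ S, (t : ℂ) ∈ K := fun t ht => ⟨t, ht, rfl⟩
  have hunif : TendstoUniformlyOn F f atTop K :=
    (tendstoLocallyUniformlyOn_iff_forall_isCompact hU).1 hlim K hKU hKc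
  -- continuity on `S`
  have hcontS : ∀ φ : ℂ → ℂ, ContinuousOn φ U → ContinuousOn (fun t : ℝ => g t • φ t) S :=
    fun φ hφ => hg.continuousOn.smul (hφ.comp continuous_ofReal.continuousOn fun t ht => hgU t ht)
  -- bounds: `f` is bounded on `K`, hence `F n` eventually
  obtain ⟨Mf, hMf⟩ := hKc.exists_bound_of_continuousOn (hfc.mono hKU)
  obtain ⟨Mg, hMg⟩ := hgs.exists_bound_of_continuous hg
  have hev : ∀ᶠ n in atTop, ∀ z ∈ K, ‖F n z‖ ≤ Mf + 1 := by
    rw [Metric.tendstoUniformlyOn_iff] at hunif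
    filter_upwards [hunif 1 one_pos] with n hn z hz
    have h1 := hn z hz
    rw [dist_eq_norm] at h1
    calc ‖F n z‖ = ‖f z - (f z - F n z)‖ := by rw [sub_sub_cancel]
      _ ≤ ‖f z‖ + ‖f z - F n z‖ := norm_sub_le _ _
      _ ≤ Mf + 1 := add_le_add (hMf z hz) h1.le
  haveI : IsFiniteMeasure ((volume : Measure ℝ).restrict S) :=
    ⟨by rw [Measure.restrict_apply_univ]; exact hSc.measure_lt_top⟩
  -- dominated convergence on `S`
  refine tendsto_integral_filter_of_dominated_convergence (fun _ => Mg * (Mf + 1)) ?_ ?_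
    (integrable_const _) ?_
  · exact Eventually.of_forall fun n =>
      (hcontS (F n) (hF n).continuousOn).aestronglyMeasurable hSc.isClosed.measurableSet
  · filter_upwards [hev] with n hn
    rw [ae_restrict_iff' hSc.isClosed.measurableSet]
    refine Eventually.of_forall fun t ht => ?_
    rw [norm_smul]
    exact mul_le_mul (hMg t) (hn _ (hmemK t ht)) (norm_nonneg _) ((norm_nonneg _).trans (hMg t))
  · rw [ae_restrict_iff' hSc.isClosed.measurableSet]
    refine Eventually.of_forall fun t ht => ?_
    exact (hunif.tendsto_at (hmemK t ht)).const_smul (g t)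

/-- **Uniqueness of subsequential limits from distributional convergence on a real segment.**
On a connected open `U ⊆ ℂ` containing the real interval `(a, b)`, `a < b`: if for every smooth
real `g` compactly supported in `(a, b)` the pairings `∫ g(t) F_n(t) dt` converge, then any two
locally uniform limits of subsequences of `F` agree on `U` (their difference is orthogonal to all
test functions on `(a, b)`, hence vanishes a.e. there, hence everywhere there by continuity,
hence on `U` by the identity theorem). [folklore] -/
theorem eqOn_of_subseq_limits_of_integral_tendsto (hU : IsOpen U) (hUc : IsPreconnected U)
    {F : ℕ → ℂ → ℂ} (hF : ∀ n, DifferentiableOn ℂ (F n) U) {a b : ℝ} (hab : a < b)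
    (hI : ∀ t ∈ Ioo a b, (t : ℂ) ∈ U)
    (hS : ∀ g : ℝ → ℝ, ContDiff ℝ ∞ g → HasCompactSupport g → tsupport g ⊆ Ioo a b →
      ∃ c : ℂ, Tendsto (fun n => ∫ t : ℝ, g t • F n t) atTop (𝓝 c))
    {f f' : ℂ → ℂ} {ψ ψ' : ℕ → ℕ} (hψ : StrictMono ψ) (hψ' : StrictMono ψ')
    (hlim : TendstoLocallyUniformlyOn (fun n => F (ψ n)) f atTop U)
    (hlim' : TendstoLocallyUniformlyOn (fun n => F (ψ' n)) f' atTop U) : EqOn f f' U := by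
  have hfd : DifferentiableOn ℂ f U := hlim.differentiableOn (Eventually.of_forall fun n => hF _) hU
  have hfd' : DifferentiableOn ℂ f' U := hlim'.differentiableOn (Eventually.of_forall fun n => hF _) hU
  -- the difference, restricted to the real axis
  set h : ℝ → ℂ := fun t => f t - f' t with hh
  have hhc : ContinuousOn h (Ioo a b) :=
    (hfd.continuousOn.comp continuous_ofReal.continuousOn hI).sub
      (hfd'.continuousOn.comp continuous_ofReal.continuousOn hI)
  -- orthogonality to test functions
  have horth : ∀ g : ℝ → ℝ, ContDiff ℝ ∞ g → HasCompactSupport g → tsupport g ⊆ Ioo a b →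
      ∫ t : ℝ, g t • h t = 0 := by
    intro g hg hgs hgI
    obtain ⟨c, hc⟩ := hS g hg hgs hgI
    have hgU : ∀ t ∈ tsupport g, (t : ℂ) ∈ U := fun t ht => hI t (hgI ht)
    have h1 := tendsto_integral_smul_of_tendstoLocallyUniformlyOn hU (fun n => hF (ψ n)) hlim
      hg.continuous hgs hgU
    have h2 := tendsto_integral_smul_of_tendstoLocallyUniformlyOn hU (fun n => hF (ψ' n)) hlim'
      hg.continuous hgs hgU
    have hc1 : Tendsto (fun n => ∫ t : ℝ, g t • F (ψ n) t) atTop (𝓝 c) := hc.comp hψ.tendsto_atTop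
    have hc2 : Tendsto (fun n => ∫ t : ℝ, g t • F (ψ' n) t) atTop (𝓝 c) := hc.comp hψ'.tendsto_atTop
    have e1 : ∫ t : ℝ, g t • f t = c := tendsto_nhds_unique h1 hc1
    have e2 : ∫ t : ℝ, g t • f' t = c := tendsto_nhds_unique h2 hc2
    have hint1 : Integrable fun t : ℝ => g t • f (t : ℂ) := by
      refine (integrableOn_iff_integrable_of_support_subset (s := tsupport g) fun t ht => ?_).1 ?_
      · have ht' : g t ≠ 0 ∧ f (t : ℂ) ≠ 0 := by
          simpa [Function.mem_support, smul_eq_zero] using ht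
        exact subset_tsupport _ ht'.1
      · exact ((hg.continuous.continuousOn.smul (hfd.continuousOn.comp
          continuous_ofReal.continuousOn hgU)).integrableOn_compact hgs)
    have hint2 : Integrable fun t : ℝ => g t • f' (t : ℂ) := by
      refine (integrableOn_iff_integrable_of_support_subset (s := tsupport g) fun t ht => ?_).1 ?_
      · have ht' : g t ≠ 0 ∧ f' (t : ℂ) ≠ 0 := by
          simpa [Function.mem_support, smul_eq_zero] using ht
        exact subset_tsupport _ ht'.1
      · exact ((hg.continuous.continuousOn.smul (hfd'.continuousOn.comp
          continuous_ofReal.continuousOn hgU)).integrableOn_compact hgs)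
    simp only [hh, smul_sub]
    rw [integral_sub hint1 hint2, e1, e2, sub_self]
  -- `h = 0` a.e. on `(a, b)`, hence everywhere there
  have hloc : LocallyIntegrableOn h (Ioo a b) := hhc.locallyIntegrableOn measurableSet_Ioo
  have hae := isOpen_Ioo.ae_eq_zero_of_integral_contDiff_smul_eq_zero hloc horth
  have hzero : ∀ t ∈ Ioo a b, f t = f' t := fun t ht =>
    sub_eq_zero.1 (eq_zero_of_ae_of_continuousOn hhc hae ht)
  -- the identity theorem
  set t₀ : ℝ := (a + b) / 2 with ht₀
  have ht₀I : t₀ ∈ Ioo a b := ⟨by rw [ht₀]; linarith, by rw [ht₀]; linarith⟩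
  have hz₀ : (t₀ : ℂ) ∈ U := hI t₀ ht₀I
  have hfreq : ∃ᶠ z in 𝓝[≠] (t₀ : ℂ), f z = f' z := by
    have htend : Tendsto (fun s : ℝ => (s : ℂ)) (𝓝[>] t₀) (𝓝[≠] (t₀ : ℂ)) := by
      have h1 : Tendsto (fun s : ℝ => (s : ℂ)) (𝓝[>] t₀) (𝓝[{(t₀ : ℂ)}ᶜ] (t₀ : ℂ)) :=
        continuous_ofReal.continuousWithinAt.tendsto_nhdsWithin fun s hs =>
          fun h => (ne_of_gt hs) (ofReal_injective h)
      simpa using h1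
    have hev : ∀ᶠ s : ℝ in 𝓝[>] t₀, f s = f' s := by
      have h1 : ∀ᶠ s : ℝ in 𝓝 t₀, s ∈ Ioo a b := isOpen_Ioo.mem_nhds ht₀I
      filter_upwards [mem_nhdsWithin_of_mem_nhds h1] with s hs using hzero s hs
    exact htend.frequently hev.frequently
  exact (hfd.analyticOnNhd hU).eqOn_of_preconnected_of_frequently_eq (hfd'.analyticOnNhd hU) hUc
    hz₀ hfreq

/-- **Vitali's theorem, distributional form.** A locally bounded sequence of holomorphic
functions on a connected open `U ⊆ ℂ` containing a real interval `(a, b)`, whose pairings with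
all smooth functions compactly supported in `(a, b)` converge, converges locally uniformly on `U`
to a holomorphic function `f`; and `∫ g f = lim ∫ g F_n` for those `g`. [folklore] -/
theorem exists_tendstoLocallyUniformlyOn_of_integral_tendsto (hU : IsOpen U)
    (hUc : IsPreconnected U) {F : ℕ → ℂ → ℂ} (hF : ∀ n, DifferentiableOn ℂ (F n) U)
    (hb : ∀ a ∈ U, ∃ M : ℝ, ∃ r > 0, ∀ n, ∀ z ∈ ball a r ∩ U, ‖F n z‖ ≤ M)
    {a b : ℝ} (hab : a < b) (hI : ∀ t ∈ Ioo a b, (t : ℂ) ∈ U)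
    (hS : ∀ g : ℝ → ℝ, ContDiff ℝ ∞ g → HasCompactSupport g → tsupport g ⊆ Ioo a b →
      ∃ c : ℂ, Tendsto (fun n => ∫ t : ℝ, g t • F n t) atTop (𝓝 c)) :
    ∃ f : ℂ → ℂ, DifferentiableOn ℂ f U ∧ TendstoLocallyUniformlyOn F f atTop U ∧
      ∀ g : ℝ → ℝ, ContDiff ℝ ∞ g → HasCompactSupport g → tsupport g ⊆ Ioo a b →
        Tendsto (fun n => ∫ t : ℝ, g t • F n t) atTop (𝓝 (∫ t : ℝ, g t • f t)) := by
  obtain ⟨f, hf, hlim⟩ := exists_tendstoLocallyUniformlyOn_of_unique_limits hU hF hb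
    fun _ _ _ _ hψ hψ' hlim hlim' =>
      eqOn_of_subseq_limits_of_integral_tendsto hU hUc hF hab hI hS hψ hψ' hlim hlim'
  exact ⟨f, hf, hlim, fun g hg hgs hgI =>
    tendsto_integral_smul_of_tendstoLocallyUniformlyOn hU hF hlim hg.continuous hgs
      fun t ht => hI t (hgI ht)⟩

end Literature.Analysis.Complex
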